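import Summits.AtomisticToContinuum.HydrodynamicLimit.Theorems.ImplosionDichotomyDenseExcursionConeLocalitySlice
import Summits.AtomisticToContinuum.HydrodynamicLimit.Theorems.ImplosionDichotomyDenseExcursionConeLocalitySource

/-!
# Cone locality for the athermal `5 × 5` Euler system — the energy method assembled

Crux `Summit.AtomisticToContinuum.HydrodynamicLimit.Theses.ImplosionDichotomy.DenseExcursion`
(stmt-AtomisticToContinuum-12586), line `kidder-knob-melnikov`, stub `stub_coneLocality : HsEulerConeLocality`.
`ConeLocality.eqOn_cone5` is the domain-of-dependence theorem (Dafermos, Hyperbolic Conservation Laws in Continuum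
Physics, 2nd ed. 2005, Thm 5.2.1, classical-vs-classical case) for the primitive full Euler system of a monatomic
fluid with a pressure law `p = PΘζ(P)`, `∂_P p = Θγ(P)`, `ζ, γ ∈ C¹(ℝ)` ARBITRARY:

  `∂ₜP + U·∇P + P div U = 0`, `P(∂ₜU + (U·∇)U) + Θγ(P)∇P + Pζ(P)∇Θ = 0`, `∂ₜΘ + U·∇Θ + (2/3)Θζ(P) div U = 0`;

two `C¹` solutions on the slab `[0, t₁) × ℝ³` which solve the system on the open backward cone
`‖x − x₀‖ + ct < R`, with densities in `[a, b]` (`a > 0`, `γ > 0` on `[a, b]`) and positive temperature of the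
first one there, `c ≥ ‖U₁‖ + c_s` (`c_s² = Θ₁γ(P₁) + (2/3)Θ₁ζ(P₁)²`) on the cone, and equal data on the ball,
coincide on the cone. Proof = the isentropic template `IsentropicEuler.eqOn_cone_of_eqOn_ball` re-run for the
`5 × 5` system: smooth cone weight `Φ = χ(R − ct − (ε² + ‖x − x₀‖²)^{1/2})`, weighted rescaled relative energy
`∫ Φ ẽ`, `ẽ = ½(Θ₁²γ(P₁)α² + P₁²Θ₁|w|² + (3/2)P₁²β²)`, the slice inequality `ConeLocality.slice_integral_le5`
(energy algebra + integrations by parts + sign of the boundary flux), the source bound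
`ConeLocality.exists_source_le_energy` on the compact support of the weight, and the abstract Grönwall lemma
`ConeLocality.eq_zero_of_weightedEnergy`. The specialisation to `HsEulerConeLocality` (one smooth law `ζ` on an
open `J ⊇ [a, b]`, `γ = ζ + id·ζ'`) is `stub_coneLocality` in the next file. Theorem-only file.
-/

noncomputable section

open Set Filter MeasureTheory Metric
open scoped Topology ContDiff RealInnerProductSpace

namespace Summit.AtomisticToContinuum.HydrodynamicLimit.Theorems.KidderKnobMelnikov

namespace ConeLocality

open Literature.Analysis.FluidPDE.IsentropicEuler
open Literature.MathematicalPhysics.KineticTheory (V3)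

set_option maxHeartbeats 4000000 in
/-- **Cone locality (domain of dependence in acoustic cones) for classical solutions of the primitive full Euler
system of a monatomic fluid with a general pressure law** `p = PΘζ(P)`, `∂_P p = Θγ(P)` (`ζ, γ ∈ C¹(ℝ)`): two
`C¹` triples on the slab `[0, t₁) × ℝ³` solving the system on the open cone `‖x − x₀‖ + ct < R` (`0 < t < t₁`),
with densities in `[a, b]` (`a > 0`, `γ > 0` on `[a, b]`) and `Θ₁ > 0` there, `‖U₁‖ + c_s ≤ c`
(`c_s² = Θ₁γ(P₁) + (2/3)Θ₁ζ(P₁)²`, `c ≥ 0`) on the cone, and equal at `t = 0` on the ball `‖x − x₀‖ < R`, agree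
on the whole cone, `0 ≤ t < t₁`. [cite: Dafermos2005, §5.2, Thm 5.2.1 and its proof (5.2.4)–(5.2.14)] -/
theorem eqOn_cone5 : ∀ {ζ γ : ℝ → ℝ} {a b : ℝ} {P₁ Θ₁ P₂ Θ₂ : ℝ → V3 → ℝ} {U₁ U₂ : ℝ → V3 → V3}
    {x₀ : V3} {R c t₁ : ℝ},
    ContDiff ℝ 1 ζ → ContDiff ℝ 1 γ → 0 < a → (∀ r ∈ Icc a b, 0 < γ r) →
    ContDiffOn ℝ 1 (fun p : ℝ × V3 => P₁ p.1 p.2) (Ico 0 t₁ ×ˢ univ) →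
    ContDiffOn ℝ 1 (fun p : ℝ × V3 => Θ₁ p.1 p.2) (Ico 0 t₁ ×ˢ univ) →
    ContDiffOn ℝ 1 (fun p : ℝ × V3 => U₁ p.1 p.2) (Ico 0 t₁ ×ˢ univ) →
    ContDiffOn ℝ 1 (fun p : ℝ × V3 => P₂ p.1 p.2) (Ico 0 t₁ ×ˢ univ) →
    ContDiffOn ℝ 1 (fun p : ℝ × V3 => Θ₂ p.1 p.2) (Ico 0 t₁ ×ˢ univ) →
    ContDiffOn ℝ 1 (fun p : ℝ × V3 => U₂ p.1 p.2) (Ico 0 t₁ ×ˢ univ) →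
    (∀ t ∈ Ico 0 t₁, ∀ x, ‖x - x₀‖ + c * t < R → P₁ t x ∈ Icc a b ∧ P₂ t x ∈ Icc a b ∧ 0 < Θ₁ t x) →
    (∀ t ∈ Ioo 0 t₁, ∀ x, ‖x - x₀‖ + c * t < R →
      (deriv (fun s => P₁ s x) t + fderiv ℝ (P₁ t) x (U₁ t x) +
          P₁ t x * ∑ i, fderiv ℝ (U₁ t) x (EuclideanSpace.single i 1) i = 0 ∧
        P₁ t x • (deriv (fun s => U₁ s x) t + fderiv ℝ (U₁ t) x (U₁ t x)) +
          (Θ₁ t x * γ (P₁ t x)) • gradient (P₁ t) x + (P₁ t x * ζ (P₁ t x)) • gradient (Θ₁ t) x = 0 ∧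
        deriv (fun s => Θ₁ s x) t + fderiv ℝ (Θ₁ t) x (U₁ t x) +
          2 / 3 * Θ₁ t x * ζ (P₁ t x) * ∑ i, fderiv ℝ (U₁ t) x (EuclideanSpace.single i 1) i = 0) ∧
      (deriv (fun s => P₂ s x) t + fderiv ℝ (P₂ t) x (U₂ t x) +
          P₂ t x * ∑ i, fderiv ℝ (U₂ t) x (EuclideanSpace.single i 1) i = 0 ∧
        P₂ t x • (deriv (fun s => U₂ s x) t + fderiv ℝ (U₂ t) x (U₂ t x)) +
          (Θ₂ t x * γ (P₂ t x)) • gradient (P₂ t) x + (P₂ t x * ζ (P₂ t x)) • gradient (Θ₂ t) x = 0 ∧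
        deriv (fun s => Θ₂ s x) t + fderiv ℝ (Θ₂ t) x (U₂ t x) +
          2 / 3 * Θ₂ t x * ζ (P₂ t x) * ∑ i, fderiv ℝ (U₂ t) x (EuclideanSpace.single i 1) i = 0)) →
    0 ≤ c →
    (∀ t ∈ Ioo 0 t₁, ∀ x, ‖x - x₀‖ + c * t < R →
      ‖U₁ t x‖ + Real.sqrt (Θ₁ t x * γ (P₁ t x) + 2 / 3 * Θ₁ t x * ζ (P₁ t x) ^ 2) ≤ c) →
    (∀ x, ‖x - x₀‖ < R → P₁ 0 x = P₂ 0 x ∧ U₁ 0 x = U₂ 0 x ∧ Θ₁ 0 x = Θ₂ 0 x) →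
    ∀ t ∈ Ico 0 t₁, ∀ x, ‖x - x₀‖ + c * t < R → P₁ t x = P₂ t x ∧ U₁ t x = U₂ t x ∧ Θ₁ t x = Θ₂ t x := by
  intro ζ γ a b P₁ Θ₁ P₂ Θ₂ U₁ U₂ x₀ R c t₁ hζ hγ ha hγpos hP₁ hΘ₁ hU₁ hP₂ hΘ₂ hU₂ hrange hE hc hspeed h0 τ hτ
    x hx
  rcases hτ.1.eq_or_lt with h | hτpos
  · subst h
    exact h0 x (by simpa using hx)
  -- ### the smooth cone weight
  set ε : ℝ := (R - c * τ - ‖x - x₀‖) / 2 with hε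
  have hε0 : 0 < ε := by rw [hε]; linarith
  set Φ : ℝ × V3 → ℝ := fun p =>
    Real.smoothTransition (R - c * p.1 - Real.sqrt (ε ^ 2 + ‖p.2 - x₀‖ ^ 2)) with hΦ
  have hΦ1 : ContDiff ℝ 1 Φ := contDiff_coneWeight hε0.ne'
  have hΦ0 : ∀ p, 0 ≤ Φ p := fun p => coneWeight_nonneg ε c R x₀ p
  have hΦs : ∀ p, Φ p ≠ 0 → ‖p.2 - x₀‖ + c * p.1 < R := fun p hp => cone_of_coneWeight_ne_zero hp
  have hΦd : ∀ p, fderiv ℝ Φ p (1, 0) + c * ‖(fderiv ℝ Φ p).comp (ContinuousLinearMap.inr ℝ ℝ V3)‖ ≤ 0 :=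
    fun p => coneWeight_flux_le hε0.ne' hc p
  have hΦx : Φ (τ, x) ≠ 0 := by
    have h := coneWeight_pos (c := c) (R := R) (x₀ := x₀) (p := (τ, x)) hx
    exact h.ne'
  have hΦfar : ∀ s, 0 ≤ s → ∀ y, R < ‖y - x₀‖ → Φ (s, y) = 0 := fun s hs y hy =>
    weight_eq_zero_far hc hΦs hs hy
  have hDΦ0 : ∀ p, Φ p = 0 → fderiv ℝ Φ p = 0 := fun p hp => fderiv_eq_zero_of_nonneg hΦ0 hp
  -- ### the compact support of the weight over `[0, τ]`
  set K : Set (ℝ × V3) :=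
    {p : ℝ × V3 | p.1 ∈ Icc 0 τ ∧ c * p.1 + Real.sqrt (ε ^ 2 + ‖p.2 - x₀‖ ^ 2) ≤ R} with hK
  have hKc : IsCompact K := isCompact_coneSet hc
  have hKS : K ⊆ Ico 0 t₁ ×ˢ univ := fun p hp => ⟨⟨hp.1.1, hp.1.2.trans_lt hτ.2⟩, mem_univ _⟩
  have hKcone : ∀ p ∈ K, ‖p.2 - x₀‖ + c * p.1 < R := fun p hp => cone_of_mem_coneSet hε0.ne' hp
  have hΦK : ∀ s ∈ Icc 0 τ, ∀ y, Φ (s, y) ≠ 0 → (s, y) ∈ K := fun s hs y hy =>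
    mem_coneSet_of_coneWeight_ne_zero (p := (s, y)) hy hs
  have hKr : ∀ p ∈ K, P₁ p.1 p.2 ∈ Icc a b ∧ P₂ p.1 p.2 ∈ Icc a b ∧ 0 < Θ₁ p.1 p.2 := fun p hp =>
    hrange p.1 ⟨hp.1.1, hp.1.2.trans_lt hτ.2⟩ p.2 (hKcone p hp)
  have hτK : (τ, x) ∈ K := hΦK τ ⟨hτpos.le, le_rfl⟩ x hΦx
  -- a positive lower bound for the temperature on `K`
  obtain ⟨p₀, hp₀, hp₀min⟩ := hKc.exists_isMinOn ⟨(τ, x), hτK⟩ (hΘ₁.continuousOn.mono hKS)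
  have hθ₀pos : 0 < Θ₁ p₀.1 p₀.2 := (hKr p₀ hp₀).2.2
  have hθ₀le : ∀ p ∈ K, Θ₁ p₀.1 p₀.2 ≤ Θ₁ p.1 p.2 := fun p hp => hp₀min hp
  -- ### slab derivatives, composite fields, energy and source
  set DP₁ : ℝ × V3 → (ℝ × V3 →L[ℝ] ℝ) := fun p =>
    fderivWithin ℝ (fun q : ℝ × V3 => P₁ q.1 q.2) (Ico 0 t₁ ×ˢ univ) p with hDP₁
  set DΘ₁ : ℝ × V3 → (ℝ × V3 →L[ℝ] ℝ) := fun p =>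
    fderivWithin ℝ (fun q : ℝ × V3 => Θ₁ q.1 q.2) (Ico 0 t₁ ×ˢ univ) p with hDΘ₁
  set DU₁ : ℝ × V3 → (ℝ × V3 →L[ℝ] V3) := fun p =>
    fderivWithin ℝ (fun q : ℝ × V3 => U₁ q.1 q.2) (Ico 0 t₁ ×ˢ univ) p with hDU₁
  set DP₂ : ℝ × V3 → (ℝ × V3 →L[ℝ] ℝ) := fun p =>
    fderivWithin ℝ (fun q : ℝ × V3 => P₂ q.1 q.2) (Ico 0 t₁ ×ˢ univ) p with hDP₂
  set DΘ₂ : ℝ × V3 → (ℝ × V3 →L[ℝ] ℝ) := fun p =>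
    fderivWithin ℝ (fun q : ℝ × V3 => Θ₂ q.1 q.2) (Ico 0 t₁ ×ˢ univ) p with hDΘ₂
  set DU₂ : ℝ × V3 → (ℝ × V3 →L[ℝ] V3) := fun p =>
    fderivWithin ℝ (fun q : ℝ × V3 => U₂ q.1 q.2) (Ico 0 t₁ ×ˢ univ) p with hDU₂
  set Da : ℝ × V3 → (ℝ × V3 →L[ℝ] ℝ) := fun p =>
    fderivWithin ℝ (fun q : ℝ × V3 => P₁ q.1 q.2 * Θ₁ q.1 q.2 ^ 2 * γ (P₁ q.1 q.2)) (Ico 0 t₁ ×ˢ univ) p with hDa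
  set Db : ℝ × V3 → (ℝ × V3 →L[ℝ] ℝ) := fun p =>
    fderivWithin ℝ (fun q : ℝ × V3 => P₁ q.1 q.2 ^ 2 * Θ₁ q.1 q.2 * ζ (P₁ q.1 q.2)) (Ico 0 t₁ ×ˢ univ) p with hDb
  set Dk : ℝ × V3 → (ℝ × V3 →L[ℝ] ℝ) := fun p =>
    fderivWithin ℝ (fun q : ℝ × V3 => Θ₁ q.1 q.2 ^ 2 * γ (P₁ q.1 q.2)) (Ico 0 t₁ ×ˢ univ) p with hDk
  set Dm : ℝ × V3 → (ℝ × V3 →L[ℝ] ℝ) := fun p =>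
    fderivWithin ℝ (fun q : ℝ × V3 => P₁ q.1 q.2 ^ 2 * Θ₁ q.1 q.2) (Ico 0 t₁ ×ˢ univ) p with hDm
  set Dn : ℝ × V3 → (ℝ × V3 →L[ℝ] ℝ) := fun p =>
    fderivWithin ℝ (fun q : ℝ × V3 => 3 / 2 * P₁ q.1 q.2 ^ 2) (Ico 0 t₁ ×ˢ univ) p with hDn
  have ha1 : ContDiffOn ℝ 1 (fun q : ℝ × V3 => P₁ q.1 q.2 * Θ₁ q.1 q.2 ^ 2 * γ (P₁ q.1 q.2))
      (Ico 0 t₁ ×ˢ univ) := by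
    fun_prop
  have hb1 : ContDiffOn ℝ 1 (fun q : ℝ × V3 => P₁ q.1 q.2 ^ 2 * Θ₁ q.1 q.2 * ζ (P₁ q.1 q.2))
      (Ico 0 t₁ ×ˢ univ) := by
    fun_prop
  have hk1 : ContDiffOn ℝ 1 (fun q : ℝ × V3 => Θ₁ q.1 q.2 ^ 2 * γ (P₁ q.1 q.2)) (Ico 0 t₁ ×ˢ univ) := by
    fun_prop
  have hm1 : ContDiffOn ℝ 1 (fun q : ℝ × V3 => P₁ q.1 q.2 ^ 2 * Θ₁ q.1 q.2) (Ico 0 t₁ ×ˢ univ) := by fun_prop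
  have hn1 : ContDiffOn ℝ 1 (fun q : ℝ × V3 => 3 / 2 * P₁ q.1 q.2 ^ 2) (Ico 0 t₁ ×ˢ univ) := by fun_prop
  set e : ℝ → V3 → ℝ := fun t y =>
    1 / 2 * (Θ₁ t y ^ 2 * γ (P₁ t y) * (P₁ t y - P₂ t y) ^ 2 + P₁ t y ^ 2 * Θ₁ t y * ‖U₁ t y - U₂ t y‖ ^ 2 +
      3 / 2 * P₁ t y ^ 2 * (Θ₁ t y - Θ₂ t y) ^ 2) with he
  set src : ℝ → V3 → ℝ := fun t y =>
    (∑ i, ((DU₁ (t, y)).comp (ContinuousLinearMap.inr ℝ ℝ V3)) (EuclideanSpace.single i 1) i) * e t y +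
      (P₁ t y - P₂ t y) * ((Da (t, y)).comp (ContinuousLinearMap.inr ℝ ℝ V3)) (U₁ t y - U₂ t y) + (Θ₁ t y -
      Θ₂ t y) * ((Db (t, y)).comp (ContinuousLinearMap.inr ℝ ℝ V3)) (U₁ t y - U₂ t y) + (-(Θ₁ t y ^ 2 *
      γ (P₁ t y) * (P₁ t y - P₂ t y) * ((DP₂ (t, y)).comp (ContinuousLinearMap.inr ℝ ℝ V3)) (U₁ t y -
      U₂ t y)) - Θ₁ t y ^ 2 * γ (P₁ t y) * (P₁ t y - P₂ t y) ^ 2 *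
      ∑ i, ((DU₂ (t, y)).comp (ContinuousLinearMap.inr ℝ ℝ V3)) (EuclideanSpace.single i 1) i - P₁ t y ^ 2 *
      Θ₁ t y * ⟪U₁ t y - U₂ t y, ((DU₂ (t, y)).comp (ContinuousLinearMap.inr ℝ ℝ V3)) (U₁ t y - U₂ t y)⟫ -
      P₁ t y * Θ₁ t y * (P₁ t y - P₂ t y) * ⟪U₁ t y -
      U₂ t y, ((DU₂ (t, y)).comp (ContinuousLinearMap.inr ℝ ℝ V3)) (U₂ t y)⟫ - P₁ t y * Θ₁ t y * ((Θ₁ t y -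
      Θ₂ t y) * γ (P₁ t y) + Θ₂ t y * (γ (P₁ t y) - γ (P₂ t y))) *
      ((DP₂ (t, y)).comp (ContinuousLinearMap.inr ℝ ℝ V3)) (U₁ t y - U₂ t y) - P₁ t y * Θ₁ t y * ((P₁ t y -
      P₂ t y) * ζ (P₁ t y) + P₂ t y * (ζ (P₁ t y) - ζ (P₂ t y))) *
      ((DΘ₂ (t, y)).comp (ContinuousLinearMap.inr ℝ ℝ V3)) (U₁ t y - U₂ t y) - P₁ t y * Θ₁ t y * (P₁ t y -
      P₂ t y) * ⟪U₁ t y - U₂ t y, DU₂ (t, y) (1, 0)⟫ - 3 / 2 * P₁ t y ^ 2 * (Θ₁ t y - Θ₂ t y) *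
      ((DΘ₂ (t, y)).comp (ContinuousLinearMap.inr ℝ ℝ V3)) (U₁ t y - U₂ t y) - P₁ t y ^ 2 * (Θ₁ t y -
      Θ₂ t y) * ((Θ₁ t y - Θ₂ t y) * ζ (P₁ t y) + Θ₂ t y * (ζ (P₁ t y) - ζ (P₂ t y))) *
      ∑ i, ((DU₂ (t, y)).comp (ContinuousLinearMap.inr ℝ ℝ V3)) (EuclideanSpace.single i 1) i) + 1 / 2 *
      (((Dk (t, y)).comp (ContinuousLinearMap.inr ℝ ℝ V3)) (U₁ t y) * (P₁ t y - P₂ t y) ^ 2 +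
      ((Dm (t, y)).comp (ContinuousLinearMap.inr ℝ ℝ V3)) (U₁ t y) * ‖U₁ t y - U₂ t y‖ ^ 2 +
      ((Dn (t, y)).comp (ContinuousLinearMap.inr ℝ ℝ V3)) (U₁ t y) * (Θ₁ t y - Θ₂ t y) ^ 2) + 1 / 2 *
      (Dk (t, y) (1, 0) * (P₁ t y - P₂ t y) ^ 2 + Dm (t, y) (1, 0) * ‖U₁ t y - U₂ t y‖ ^ 2 +
      Dn (t, y) (1, 0) * (Θ₁ t y - Θ₂ t y) ^ 2) with hsrc
  have he1 : ContDiffOn ℝ 1 (fun p : ℝ × V3 => e p.1 p.2) (Ico 0 t₁ ×ˢ univ) := by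
    have hw2 := (hU₁.sub hU₂).norm_sq ℝ
    show ContDiffOn ℝ 1 (fun p : ℝ × V3 => 1 / 2 * (Θ₁ p.1 p.2 ^ 2 * γ (P₁ p.1 p.2) * (P₁ p.1 p.2 - P₂ p.1 p.2) ^ 2 +
        P₁ p.1 p.2 ^ 2 * Θ₁ p.1 p.2 * ‖U₁ p.1 p.2 - U₂ p.1 p.2‖ ^ 2 + 3 / 2 * P₁ p.1 p.2 ^ 2 * (Θ₁ p.1 p.2 - Θ₂ p.1 p.2) ^ 2)) (Ico 0 t₁ ×ˢ univ)
    fun_prop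
  -- ### the source bound on `K`
  obtain ⟨M, hM⟩ := exists_source_le_energy (K := K) (DU₁ := DU₁) (DU₂ := DU₂) (DP₂ := DP₂) (DΘ₂ := DΘ₂)
    (Da := Da) (Db := Db) (Dk := Dk) (Dm := Dm) (Dn := Dn) (e := e) (src := src) hζ hγ hP₁ hΘ₁ hU₁ hP₂ hΘ₂ hU₂
    (fun _ => rfl) (fun _ => rfl) (fun _ => rfl) (fun _ => rfl) (fun _ => rfl) (fun _ => rfl) (fun _ => rfl)
    (fun _ => rfl) (fun _ => rfl) (fun _ _ => rfl) (fun _ _ => rfl) hKc hKS ha hθ₀pos hγpos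
    (fun s y h => ⟨(hKr (s, y) h).1, (hKr (s, y) h).2.1, hθ₀le (s, y) h⟩)
  -- ### the weighted density and its time derivative
  set D : ℝ → V3 → ℝ := fun s y => Φ (s, y) * e s y with hD
  set F' : ℝ → V3 → ℝ := fun s y => fderiv ℝ Φ (s, y) (1, 0) * e s y +
    Φ (s, y) * fderivWithin ℝ (fun q : ℝ × V3 => e q.1 q.2) (Ico 0 t₁ ×ˢ univ) (s, y) (1, 0) with hF'
  have hec : ContinuousOn (fun p : ℝ × V3 => e p.1 p.2) (Ico 0 t₁ ×ˢ univ) := he1.continuousOn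
  have hDec : ContinuousOn (fun p : ℝ × V3 => fderivWithin ℝ (fun q : ℝ × V3 => e q.1 q.2) (Ico 0 t₁ ×ˢ univ) p)
      (Ico 0 t₁ ×ˢ univ) := continuousOn_fderivWithin_slab he1
  have hΦc : Continuous Φ := hΦ1.continuous
  have hΦtc : Continuous fun p : ℝ × V3 => fderiv ℝ Φ p (1, 0) :=
    (hΦ1.continuous_fderiv one_ne_zero).clm_apply continuous_const
  have hF'S : ContinuousOn (fun p : ℝ × V3 => F' p.1 p.2) (Ico 0 t₁ ×ˢ univ) :=
    (hΦtc.continuousOn.mul hec).add (hΦc.continuousOn.mul (hDec.clm_apply continuousOn_const))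
  have hDc : ContinuousOn (fun p : ℝ × V3 => D p.1 p.2) (Icc 0 τ ×ˢ univ) :=
    (hΦc.continuousOn.mul hec).mono (prod_mono (Icc_subset_Ico_right hτ.2) le_rfl)
  have hF'c : ContinuousOn (fun p : ℝ × V3 => F' p.1 p.2) (Ioc 0 τ ×ˢ univ) :=
    hF'S.mono (prod_mono (Ioc_subset_Icc_self.trans (Icc_subset_Ico_right hτ.2)) le_rfl)
  have hderiv : ∀ s ∈ Ioc 0 τ, ∀ y, HasDerivAt (fun r => D r y) (F' s y) s := by
    intro s hs y
    have hsO : s ∈ Ioo 0 t₁ := ⟨hs.1, hs.2.trans_lt hτ.2⟩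
    have h1 : HasDerivAt (fun r => Φ (r, y)) (fderiv ℝ Φ (s, y) (1, 0)) s :=
      hasDerivAt_slice_left ((hΦ1.differentiable one_ne_zero) _).hasFDerivAt
    exact h1.mul (hasDerivAt_time (u := e) he1 hsO y)
  have hDfar : ∀ s ∈ Icc 0 τ, ∀ y, R < ‖y - x₀‖ → D s y = 0 := fun s hs y hy => by
    simp only [hD]; rw [hΦfar s hs.1 y hy, zero_mul]
  have hF'far : ∀ s ∈ Ioc 0 τ, ∀ y, R < ‖y - x₀‖ → F' s y = 0 := fun s hs y hy => by
    simp only [hF']; rw [hΦfar s hs.1.le y hy, hDΦ0 _ (hΦfar s hs.1.le y hy)]; simp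
  have hF'b : ∃ C, ∀ s ∈ Ioc 0 τ, ∀ y, |F' s y| ≤ C := by
    have hKc' : IsCompact (Icc 0 τ ×ˢ closedBall x₀ R) := isCompact_Icc.prod (isCompact_closedBall x₀ R)
    obtain ⟨C, hC⟩ := hKc'.exists_bound_of_continuousOn
      (hF'S.mono (prod_mono (Icc_subset_Ico_right hτ.2) (subset_univ _)))
    refine ⟨max C 0, fun s hs y => ?_⟩
    by_cases hy : y ∈ closedBall x₀ R
    · have h := hC (s, y) ⟨⟨hs.1.le, hs.2⟩, hy⟩
      rw [Real.norm_eq_abs] at h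
      exact h.trans (le_max_left _ _)
    · rw [mem_closedBall, dist_eq_norm, not_le] at hy
      rw [hF'far s hs y hy, abs_zero]
      exact le_max_right _ _
  obtain ⟨C, hC⟩ := hF'b
  have hD0 : ∀ y, D 0 y = 0 := by
    intro y
    simp only [hD]
    by_cases hy : Φ (0, y) = 0
    · rw [hy, zero_mul]
    · have hcone := hΦs (0, y) hy
      simp only [mul_zero, add_zero] at hcone
      obtain ⟨hP, hU, hΘ⟩ := h0 y hcone
      simp only [he, hP, hU, hΘ, sub_self, norm_zero]
      ring
  have hDnn : ∀ s ∈ Icc 0 τ, ∀ y, 0 ≤ D s y := by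
    intro s hs y
    simp only [hD]
    by_cases hy : Φ (s, y) = 0
    · rw [hy, zero_mul]
    · obtain ⟨hP₁ab, -, hΘpos⟩ := hKr (s, y) (hΦK s hs y hy)
      have hγP : 0 ≤ γ (P₁ s y) := (hγpos _ hP₁ab).le
      refine mul_nonneg (hΦ0 _) ?_
      simp only [he]
      have h1 : 0 ≤ Θ₁ s y ^ 2 * γ (P₁ s y) * (P₁ s y - P₂ s y) ^ 2 :=
        mul_nonneg (mul_nonneg (sq_nonneg _) hγP) (sq_nonneg _)
      have h2 : 0 ≤ P₁ s y ^ 2 * Θ₁ s y * ‖U₁ s y - U₂ s y‖ ^ 2 :=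
        mul_nonneg (mul_nonneg (sq_nonneg _) hΘpos.le) (sq_nonneg _)
      have h3 : 0 ≤ 3 / 2 * P₁ s y ^ 2 * (Θ₁ s y - Θ₂ s y) ^ 2 := by positivity
      linarith
  -- ### the slice inequality
  have hslice : ∀ s ∈ Ioc 0 τ, ∫ y, F' s y ≤ M * ∫ y, D s y := by
    intro s hs
    have hsO : s ∈ Ioo 0 t₁ := ⟨hs.1, hs.2.trans_lt hτ.2⟩
    have hsI : s ∈ Icc 0 τ := ⟨hs.1.le, hs.2⟩
    -- the time derivative of the energy in explicit form
    have hdte : ∀ y, fderivWithin ℝ (fun q : ℝ × V3 => e q.1 q.2) (Ico 0 t₁ ×ˢ univ) (s, y) (1, 0) =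
        Θ₁ s y ^ 2 * γ (P₁ s y) * (P₁ s y - P₂ s y) * (DP₁ (s, y) (1, 0) - DP₂ (s, y) (1, 0)) +
          P₁ s y ^ 2 * Θ₁ s y * ⟪U₁ s y - U₂ s y, DU₁ (s, y) (1, 0) - DU₂ (s, y) (1, 0)⟫ +
          3 / 2 * P₁ s y ^ 2 * (Θ₁ s y - Θ₂ s y) * (DΘ₁ (s, y) (1, 0) - DΘ₂ (s, y) (1, 0)) +
          1 / 2 * (Dk (s, y) (1, 0) * (P₁ s y - P₂ s y) ^ 2 + Dm (s, y) (1, 0) * ‖U₁ s y - U₂ s y‖ ^ 2 +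
            Dn (s, y) (1, 0) * (Θ₁ s y - Θ₂ s y) ^ 2) := by
      intro y
      have h1 := hasDerivAt_time (u := e) he1 hsO y
      have h2 := hasDerivAt_energy5
        (hasDerivAt_time (u := fun r y => Θ₁ r y ^ 2 * γ (P₁ r y)) hk1 hsO y)
        (hasDerivAt_time (u := fun r y => P₁ r y ^ 2 * Θ₁ r y) hm1 hsO y)
        (hasDerivAt_time (u := fun r y => 3 / 2 * P₁ r y ^ 2) hn1 hsO y)
        (hasDerivAt_time hP₁ hsO y) (hasDerivAt_time hP₂ hsO y) (hasDerivAt_time hΘ₁ hsO y)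
        (hasDerivAt_time hΘ₂ hsO y) (hasDerivAt_time hU₁ hsO y) (hasDerivAt_time hU₂ hsO y)
      exact h1.unique h2
    have hF's : (fun y => F' s y) = fun y => fderiv ℝ Φ (s, y) (1, 0) * e s y + Φ (s, y) *
        (Θ₁ s y ^ 2 * γ (P₁ s y) * (P₁ s y - P₂ s y) * (DP₁ (s, y) (1, 0) - DP₂ (s, y) (1, 0)) +
          P₁ s y ^ 2 * Θ₁ s y * ⟪U₁ s y - U₂ s y, DU₁ (s, y) (1, 0) - DU₂ (s, y) (1, 0)⟫ +
          3 / 2 * P₁ s y ^ 2 * (Θ₁ s y - Θ₂ s y) * (DΘ₁ (s, y) (1, 0) - DΘ₂ (s, y) (1, 0)) +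
          1 / 2 * (Dk (s, y) (1, 0) * (P₁ s y - P₂ s y) ^ 2 + Dm (s, y) (1, 0) * ‖U₁ s y - U₂ s y‖ ^ 2 +
            Dn (s, y) (1, 0) * (Θ₁ s y - Θ₂ s y) ^ 2)) := by
      funext y
      simp only [hF', hdte]
    rw [hF's]
    have hφ1 : ContDiff ℝ 1 fun y => Φ (s, y) := hΦ1.comp (contDiff_const.prodMk contDiff_id)
    have hslice_fderiv : ∀ y, fderiv ℝ (fun y => Φ (s, y)) y =
        (fderiv ℝ Φ (s, y)).comp (ContinuousLinearMap.inr ℝ ℝ V3) := fun y =>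
      (hasFDerivAt_slice_right ((hΦ1.differentiable one_ne_zero) _).hasFDerivAt).fderiv
    refine slice_integral_le5 (φ := fun y => Φ (s, y)) (ψ := fun y => fderiv ℝ Φ (s, y) (1, 0))
      (P := P₁ s) (Θ := Θ₁ s) (U := U₁ s) (P₂ := P₂ s) (Θ₂ := Θ₂ s) (U₂ := U₂ s)
      (dP := fun y => DP₁ (s, y) (1, 0)) (dΘ := fun y => DΘ₁ (s, y) (1, 0)) (dU := fun y => DU₁ (s, y) (1, 0))
      (dP₂ := fun y => DP₂ (s, y) (1, 0)) (dΘ₂ := fun y => DΘ₂ (s, y) (1, 0))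
      (dU₂ := fun y => DU₂ (s, y) (1, 0)) (dk := fun y => Dk (s, y) (1, 0)) (dm := fun y => Dm (s, y) (1, 0))
      (dn := fun y => Dn (s, y) (1, 0)) (e := e s) (src := src s)
      (LP := fun y => (DP₁ (s, y)).comp (ContinuousLinearMap.inr ℝ ℝ V3))
      (LΘ := fun y => (DΘ₁ (s, y)).comp (ContinuousLinearMap.inr ℝ ℝ V3))
      (LP₂ := fun y => (DP₂ (s, y)).comp (ContinuousLinearMap.inr ℝ ℝ V3))
      (LΘ₂ := fun y => (DΘ₂ (s, y)).comp (ContinuousLinearMap.inr ℝ ℝ V3))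
      (Lk := fun y => (Dk (s, y)).comp (ContinuousLinearMap.inr ℝ ℝ V3))
      (Lm := fun y => (Dm (s, y)).comp (ContinuousLinearMap.inr ℝ ℝ V3))
      (Ln := fun y => (Dn (s, y)).comp (ContinuousLinearMap.inr ℝ ℝ V3))
      (La := fun y => (Da (s, y)).comp (ContinuousLinearMap.inr ℝ ℝ V3))
      (Lb := fun y => (Db (s, y)).comp (ContinuousLinearMap.inr ℝ ℝ V3))
      (AU := fun y => (DU₁ (s, y)).comp (ContinuousLinearMap.inr ℝ ℝ V3))
      (AU₂ := fun y => (DU₂ (s, y)).comp (ContinuousLinearMap.inr ℝ ℝ V3)) (x₀ := x₀) (R := R) (c := c) (M := M)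
      hζ hγ hφ1 (fun y => hΦ0 _) ?_
      (((hΦ1.continuous_fderiv one_ne_zero).comp (continuous_const.prodMk continuous_id)).clm_apply
        continuous_const) ?_ ?_
      (contDiff_space hP₁ hsO) (contDiff_space hΘ₁ hsO) (contDiff_space hU₁ hsO)
      (contDiff_space hP₂ hsO) (contDiff_space hΘ₂ hsO) (contDiff_space hU₂ hsO)
      (fun y => hasFDerivAt_space hP₁ hsO y) (fun y => hasFDerivAt_space hΘ₁ hsO y)
      (fun y => hasFDerivAt_space hU₁ hsO y) (fun y => hasFDerivAt_space hP₂ hsO y)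
      (fun y => hasFDerivAt_space hΘ₂ hsO y) (fun y => hasFDerivAt_space hU₂ hsO y)
      (fun y => hasFDerivAt_space (u := fun r y => Θ₁ r y ^ 2 * γ (P₁ r y)) hk1 hsO y)
      (fun y => hasFDerivAt_space (u := fun r y => P₁ r y ^ 2 * Θ₁ r y) hm1 hsO y)
      (fun y => hasFDerivAt_space (u := fun r y => 3 / 2 * P₁ r y ^ 2) hn1 hsO y)
      (fun y => hasFDerivAt_space (u := fun r y => P₁ r y * Θ₁ r y ^ 2 * γ (P₁ r y)) ha1 hsO y)
      (fun y => hasFDerivAt_space (u := fun r y => P₁ r y ^ 2 * Θ₁ r y * ζ (P₁ r y)) hb1 hsO y)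
      ((continuous_fderiv_slice hP₁ hsO).clm_apply continuous_const)
      ((continuous_fderiv_slice hΘ₁ hsO).clm_apply continuous_const)
      ((continuous_fderiv_slice hU₁ hsO).clm_apply continuous_const)
      ((continuous_fderiv_slice hP₂ hsO).clm_apply continuous_const)
      ((continuous_fderiv_slice hΘ₂ hsO).clm_apply continuous_const)
      ((continuous_fderiv_slice hU₂ hsO).clm_apply continuous_const)
      ((continuous_fderiv_slice hk1 hsO).clm_apply continuous_const)
      ((continuous_fderiv_slice hm1 hsO).clm_apply continuous_const)
      ((continuous_fderiv_slice hn1 hsO).clm_apply continuous_const)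
      (fun y => rfl) (fun y => rfl) ?_ ?_ ?_ ?_
    · -- support in the ball
      intro y hy
      have h := hΦs (s, y) hy
      simp only at h
      nlinarith [mul_nonneg hc hs.1.le]
    · -- `∂ₜΦ` vanishes with `Φ`
      intro y hy
      rw [hDΦ0 _ hy]; simp
    · -- recession condition
      intro y
      rw [hslice_fderiv y]
      exact hΦd (s, y)
    · -- the equations on the support of the weight
      intro y hy
      have h := hE s hsO y (hΦs (s, y) hy)
      rw [(hasDerivAt_time hP₁ hsO y).deriv, (hasDerivAt_time hU₁ hsO y).deriv, (hasDerivAt_time hΘ₁ hsO y).deriv,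
        (hasDerivAt_time hP₂ hsO y).deriv, (hasDerivAt_time hU₂ hsO y).deriv,
        (hasDerivAt_time hΘ₂ hsO y).deriv] at h
      exact h
    · -- signs
      intro y hy
      obtain ⟨hP₁ab, -, hΘpos⟩ := hKr (s, y) (hΦK s hsI y hy)
      exact ⟨hΘpos.le, (hγpos _ hP₁ab).le⟩
    · -- the speed bound
      intro y hy
      exact hspeed s hsO y (hΦs (s, y) hy)
    · -- the source bound
      intro y hy
      exact hM s y (hΦK s hsI y hy)
  -- ### conclusion
  have hzero := eq_zero_of_weightedEnergy (D := D) (F' := F') hτpos hDc hF'c hderiv hC hDfar hF'far hD0 hDnn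
    hslice x
  have hex : e τ x = 0 := (mul_eq_zero.1 hzero).resolve_left hΦx
  obtain ⟨hP₁ab, -, hΘpos⟩ := hKr (τ, x) hτK
  have hPpos : 0 < P₁ τ x := ha.trans_le hP₁ab.1
  have hA : 0 < Θ₁ τ x ^ 2 * γ (P₁ τ x) := mul_pos (pow_pos hΘpos 2) (hγpos _ hP₁ab)
  have hr : 0 < P₁ τ x ^ 2 * Θ₁ τ x := mul_pos (pow_pos hPpos 2) hΘpos
  have hB : 0 < 3 / 2 * P₁ τ x ^ 2 := mul_pos (by norm_num) (pow_pos hPpos 2)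
  have hsum : Θ₁ τ x ^ 2 * γ (P₁ τ x) * (P₁ τ x - P₂ τ x) ^ 2 + P₁ τ x ^ 2 * Θ₁ τ x * ‖U₁ τ x - U₂ τ x‖ ^ 2 +
      3 / 2 * P₁ τ x ^ 2 * (Θ₁ τ x - Θ₂ τ x) ^ 2 = 0 := by
    have h : e τ x = 1 / 2 * (Θ₁ τ x ^ 2 * γ (P₁ τ x) * (P₁ τ x - P₂ τ x) ^ 2 + P₁ τ x ^ 2 * Θ₁ τ x * ‖U₁ τ x - U₂ τ x‖ ^ 2 +
      3 / 2 * P₁ τ x ^ 2 * (Θ₁ τ x - Θ₂ τ x) ^ 2) := rfl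
    rw [h] at hex
    linarith
  have h1 : 0 ≤ Θ₁ τ x ^ 2 * γ (P₁ τ x) * (P₁ τ x - P₂ τ x) ^ 2 := mul_nonneg hA.le (sq_nonneg _)
  have h2 : 0 ≤ P₁ τ x ^ 2 * Θ₁ τ x * ‖U₁ τ x - U₂ τ x‖ ^ 2 := mul_nonneg hr.le (sq_nonneg _)
  have h3 : 0 ≤ 3 / 2 * P₁ τ x ^ 2 * (Θ₁ τ x - Θ₂ τ x) ^ 2 := mul_nonneg hB.le (sq_nonneg _)
  have hα : (P₁ τ x - P₂ τ x) ^ 2 = 0 := by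
    have h : Θ₁ τ x ^ 2 * γ (P₁ τ x) * (P₁ τ x - P₂ τ x) ^ 2 = 0 := by linarith
    exact (mul_eq_zero.1 h).resolve_left hA.ne'
  have hw : ‖U₁ τ x - U₂ τ x‖ ^ 2 = 0 := by
    have h : P₁ τ x ^ 2 * Θ₁ τ x * ‖U₁ τ x - U₂ τ x‖ ^ 2 = 0 := by linarith
    exact (mul_eq_zero.1 h).resolve_left hr.ne'
  have hβ : (Θ₁ τ x - Θ₂ τ x) ^ 2 = 0 := by
    have h : 3 / 2 * P₁ τ x ^ 2 * (Θ₁ τ x - Θ₂ τ x) ^ 2 = 0 := by linarith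
    exact (mul_eq_zero.1 h).resolve_left hB.ne'
  rw [sq_eq_zero_iff, sub_eq_zero] at hα hβ
  rw [sq_eq_zero_iff, norm_eq_zero, sub_eq_zero] at hw
  exact ⟨hα, hw, hβ⟩

end ConeLocality

end Summit.AtomisticToContinuum.HydrodynamicLimit.Theorems.KidderKnobMelnikov

end
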